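import Literature.Computability.AlgebraicComplexity.InterfaceBlockCounts
import Literature.Computability.AlgebraicComplexity.TensorCells
import HarnessLib

/-!
# The cells of an `ε`-interface tensor by realised split types are exact interface tensors
(Vassilevska Williams–Xu–Xu–Zhou 2024, Thm. 5.3, proof: "we merge the level-`ℓ` interface tensors
into a level-`ℓ` `ε`-interface tensor") — proved

Topic `Literature/Computability/AlgebraicComplexity`.  A level-`ℓ` `ε`-interface tensor
`𝒯_{τ,L,ε}` (Def. 3.6/4.1, `interfaceTensor`) keeps the level-1 blocks whose complete split
distribution on every term is within `ε` of the prescribed one.  Label each variable by the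
**realised split profile** of its level-1 block — the counts `#{u ∈ term t | Î_u = σ}`
(`splitProfile`, finitely many values).  This file PROVES:

* `mem_admissibleSeqs_iff_splitProfile` — admissibility (levels and `ε`-consistency) of a level-1
  sequence depends only on its split profile;
* `partSubtensor_interfaceTensor_cell_eq` — **the cell of `𝒯_{τ,L,ε}` over a realised triple of
  profiles `(a, b, c)` IS the exact interface tensor `𝒯_{τ,L[a,b,c],0}`** whose split distributions
  are the realised ones (`cellTermList`: `γ_X^{(t)} = a_t / n_t`, …), and these are within `ε` of the
  prescribed ones on every non-empty term (`abs_cellGamma_sub_le`);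
* `vxxz2024_thm53_merge` — **`⊕_{realised cells} 𝒯_{τ,L[cell],0} ≥ 𝒯_{τ,L,ε}`**: the `ε`-interface
  tensor is a restriction (so a degeneration) of the direct sum, over the at most
  `((n+1)^{3^c · s})^3` realised cells (`card_realisedCells_le`), of exact interface tensors with
  `ε`-close split distributions — the "merge" of the proof of Thm. 5.3 read backwards
  (`TensorCells.lean`).

Everything is proved; the definitions are the profile, the cell data and the realised cells; no
named facts.

## References

* V. Vassilevska Williams, Y. Xu, Z. Xu, R. Zhou, *New bounds for matrix multiplication: from alpha
  to omega*, SODA 2024, arXiv:2307.07970 (held: `paper:arxiv-2307.07970`), Def. 3.6, Def. 4.1 and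
  Thm. 5.3 (proof sketch). [VassilevskaWilliamsXuXuZhou2024]
-/

noncomputable section

open scoped BigOperators
open Finset

namespace Literature.Computability.AlgebraicComplexity

open Literature.Barriers.MatrixMultiplication (bigCwTensor)

universe u

/-! ## Split profiles -/

section Profile

variable {c n s : ℕ}

/-- **The realised split profile** of a level-1 sequence: for each term `t` and chunk shape `σ`, the
number of chunks of term `t` equal to `σ` (so `split(Î, term t)(σ) = profile(t, σ) / n_t`).
[cite: VassilevskaWilliamsXuXuZhou2024, Def. 3.4–3.5] -/
def splitProfile (τ : Fin n → Fin s) (I : Fin n → Fin c → Fin 3) : Fin s → (Fin c → Fin 3) → Fin (n + 1) :=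
  fun t σ => ⟨((termFibre τ t).filter fun u => I u = σ).card,
    Nat.lt_succ_of_le ((card_le_univ _).trans_eq (Fintype.card_fin n))⟩

/-- Values of the profile. [folklore] -/
theorem splitProfile_val (τ : Fin n → Fin s) (I : Fin n → Fin c → Fin 3) (t : Fin s) (σ : Fin c → Fin 3) :
    (splitProfile τ I t σ : ℕ) = ((termFibre τ t).filter fun u => I u = σ).card := rfl

/-- The complete split distribution on a term is the profile divided by the term size. [cite: VassilevskaWilliamsXuXuZhou2024, Def. 3.5] -/
theorem completeSplitOn_termFibre_eq (τ : Fin n → Fin s) (I : Fin n → Fin c → Fin 3) (t : Fin s) (σ : Fin c → Fin 3) :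
    completeSplitOn I (termFibre τ t) σ = ((splitProfile τ I t σ : ℕ) : ℝ) / (termFibre τ t).card := rfl

/-- A shape occurs in term `t` iff its profile count is non-zero. [folklore] -/
theorem splitProfile_ne_zero_iff (τ : Fin n → Fin s) (I : Fin n → Fin c → Fin 3) (t : Fin s) (σ : Fin c → Fin 3) :
    (splitProfile τ I t σ : ℕ) ≠ 0 ↔ ∃ u, τ u = t ∧ I u = σ := by
  rw [splitProfile_val, ← pos_iff_ne_zero, card_pos]
  constructor
  · rintro ⟨u, hu⟩
    simp only [mem_filter, mem_univ, true_and] at hu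
    exact ⟨u, hu.1, hu.2⟩
  · rintro ⟨u, h1, h2⟩
    exact ⟨u, by simp [h1, h2]⟩

/-- The profile vanishes on empty terms. [folklore] -/
theorem splitProfile_eq_zero_of_termFibre_eq_empty (τ : Fin n → Fin s) (I : Fin n → Fin c → Fin 3) {t : Fin s}
    (ht : termFibre τ t = ∅) (σ : Fin c → Fin 3) : (splitProfile τ I t σ : ℕ) = 0 := by
  rw [splitProfile_val, ht, filter_empty, card_empty]

/-- **Admissibility depends only on the profile**: the level condition says that only shapes of
level `deg t` occur in term `t`, and `ε`-consistency compares `profile/n_t` with `γ`.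
[cite: VassilevskaWilliamsXuXuZhou2024, Def. 3.6 and Def. 4.1] -/
theorem mem_admissibleSeqs_iff_splitProfile (τ : Fin n → Fin s) (deg : Fin s → ℕ)
    (γ : Fin s → (Fin c → Fin 3) → ℝ) (ε : ℝ) (I : Fin n → Fin c → Fin 3) :
    I ∈ admissibleSeqs τ deg γ ε ↔
      (∀ t σ, (splitProfile τ I t σ : ℕ) ≠ 0 → patternLevel σ = deg t) ∧
        ∀ t, (termFibre τ t).Nonempty →
          ∀ σ, |((splitProfile τ I t σ : ℕ) : ℝ) / (termFibre τ t).card - γ t σ| ≤ ε := by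
  rw [mem_admissibleSeqs]
  refine and_congr ?_ ?_
  · constructor
    · intro h t σ hne
      obtain ⟨u, hu, hI⟩ := (splitProfile_ne_zero_iff τ I t σ).1 hne
      rw [← hI, h u, hu]
    · intro h u
      exact h (τ u) (I u) ((splitProfile_ne_zero_iff τ I (τ u) (I u)).2 ⟨u, rfl, rfl⟩)
  · rfl

/-- Sequences with the same profile are admissible together. [cite: VassilevskaWilliamsXuXuZhou2024, Def. 4.1] -/
theorem mem_admissibleSeqs_of_splitProfile_eq {τ : Fin n → Fin s} {deg : Fin s → ℕ}
    {γ : Fin s → (Fin c → Fin 3) → ℝ} {ε : ℝ} {I I' : Fin n → Fin c → Fin 3}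
    (h : splitProfile τ I' = splitProfile τ I) (hI : I ∈ admissibleSeqs τ deg γ ε) :
    I' ∈ admissibleSeqs τ deg γ ε := by
  rw [mem_admissibleSeqs_iff_splitProfile] at hI ⊢
  rw [h]
  exact hI

/-! ### The cell data -/

/-- The split distributions of a cell: `a_t / n_t`. [cite: VassilevskaWilliamsXuXuZhou2024, Thm. 5.3 (proof: "target complete split distributions slightly different in each application")] -/
def cellGamma (τ : Fin n → Fin s) (a : Fin s → (Fin c → Fin 3) → Fin (n + 1)) : Fin s → (Fin c → Fin 3) → ℝ :=
  fun t σ => ((a t σ : ℕ) : ℝ) / (termFibre τ t).card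

/-- **The parameter list of a cell**: the terms of `L` with the realised split distributions
`a/n_t, b/n_t, c/n_t` in place of `γ_X, γ_Y, γ_Z`. [cite: VassilevskaWilliamsXuXuZhou2024, Thm. 5.3 (proof)] -/
def cellTermList (τ : Fin n → Fin s) (L : Fin s → InterfaceTerm c)
    (abc : (Fin s → (Fin c → Fin 3) → Fin (n + 1)) × (Fin s → (Fin c → Fin 3) → Fin (n + 1)) ×
      (Fin s → (Fin c → Fin 3) → Fin (n + 1))) : Fin s → InterfaceTerm c :=
  fun t => ⟨(L t).i, (L t).j, (L t).k, cellGamma τ abc.1 t, cellGamma τ abc.2.1 t, cellGamma τ abc.2.2 t⟩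

/-- **Exact admissibility for the cell data = having the cell's profile**, for a profile realised by
an admissible sequence. [cite: VassilevskaWilliamsXuXuZhou2024, Def. 4.1] -/
theorem mem_admissibleSeqs_cell_iff {τ : Fin n → Fin s} {deg : Fin s → ℕ} {γ : Fin s → (Fin c → Fin 3) → ℝ}
    {ε : ℝ} {I₀ : Fin n → Fin c → Fin 3} (hI₀ : I₀ ∈ admissibleSeqs τ deg γ ε) (I : Fin n → Fin c → Fin 3) :
    I ∈ admissibleSeqs τ deg (cellGamma τ (splitProfile τ I₀)) 0 ↔ splitProfile τ I = splitProfile τ I₀ := by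
  rw [mem_admissibleSeqs_iff_splitProfile]
  have hlev₀ := ((mem_admissibleSeqs_iff_splitProfile τ deg γ ε I₀).1 hI₀).1
  constructor
  · rintro ⟨-, hsplit⟩
    funext t σ
    apply Fin.ext
    rcases (termFibre τ t).eq_empty_or_nonempty with h0 | hne
    · rw [splitProfile_eq_zero_of_termFibre_eq_empty τ I h0, splitProfile_eq_zero_of_termFibre_eq_empty τ I₀ h0]
    · have h := hsplit t hne σ
      rw [abs_nonpos_iff, sub_eq_zero, cellGamma] at h
      have hcard : ((termFibre τ t).card : ℝ) ≠ 0 := by exact_mod_cast (card_pos.2 hne).ne'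
      rw [div_left_inj' hcard] at h
      exact_mod_cast h
  · intro h
    refine ⟨fun t σ hne => hlev₀ t σ (by rwa [h] at hne), fun t _ σ => ?_⟩
    rw [h, cellGamma, sub_self, abs_zero]

/-- **The realised split distributions are `ε`-close to the prescribed ones** on non-empty terms.
[cite: VassilevskaWilliamsXuXuZhou2024, Thm. 5.3 (proof: "up to ε in L_∞ distance")] -/
theorem abs_cellGamma_sub_le {τ : Fin n → Fin s} {deg : Fin s → ℕ} {γ : Fin s → (Fin c → Fin 3) → ℝ}
    {ε : ℝ} {I₀ : Fin n → Fin c → Fin 3} (hI₀ : I₀ ∈ admissibleSeqs τ deg γ ε) {t : Fin s}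
    (ht : (termFibre τ t).Nonempty) (σ : Fin c → Fin 3) :
    |cellGamma τ (splitProfile τ I₀) t σ - γ t σ| ≤ ε :=
  ((mem_admissibleSeqs_iff_splitProfile τ deg γ ε I₀).1 hI₀).2 t ht σ

end Profile

/-! ## The cells of an `ε`-interface tensor -/

section Cells

variable (K : Type u) [CommSemiring K] (q : ℕ) {c n s : ℕ}

/-- The part map: a variable goes to the split profile of its level-1 block. [cite: VassilevskaWilliamsXuXuZhou2024, Thm. 5.3 (proof)] -/
abbrev profileOf (τ : Fin n → Fin s) (x : Fin n → Fin c → Fin (q + 2)) : Fin s → (Fin c → Fin 3) → Fin (n + 1) :=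
  splitProfile τ (levelSeq x)

/-- **The cell of `𝒯_{τ,L,ε}` over a realised triple of profiles is the exact interface tensor of the
cell data.** [cite: VassilevskaWilliamsXuXuZhou2024, Thm. 5.3 (proof)] -/
theorem partSubtensor_interfaceTensor_cell_eq (τ : Fin n → Fin s) (L : Fin s → InterfaceTerm c) (ε : ℝ)
    {x₀ y₀ z₀ : Fin n → Fin c → Fin (q + 2)} (hx₀ : levelSeq x₀ ∈ levelBlocksX τ L ε)
    (hy₀ : levelSeq y₀ ∈ levelBlocksY τ L ε) (hz₀ : levelSeq z₀ ∈ levelBlocksZ τ L ε) :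
    partSubtensor (profileOf q τ) (profileOf q τ) (profileOf q τ) (interfaceTensor K q τ L ε)
        {profileOf q τ x₀} {profileOf q τ y₀} {profileOf q τ z₀} =
      interfaceTensor K q τ (cellTermList τ L (profileOf q τ x₀, profileOf q τ y₀, profileOf q τ z₀)) 0 := by
  funext x y z
  rw [partSubtensor_apply, interfaceTensor_apply, interfaceTensor_apply]
  simp only [mem_singleton]
  -- membership in the cell blocks = having the profile
  have hX : levelSeq x ∈ levelBlocksX τ (cellTermList τ L (profileOf q τ x₀, profileOf q τ y₀, profileOf q τ z₀)) 0 ↔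
      profileOf q τ x = profileOf q τ x₀ := mem_admissibleSeqs_cell_iff hx₀ (levelSeq x)
  have hY : levelSeq y ∈ levelBlocksY τ (cellTermList τ L (profileOf q τ x₀, profileOf q τ y₀, profileOf q τ z₀)) 0 ↔
      profileOf q τ y = profileOf q τ y₀ := mem_admissibleSeqs_cell_iff hy₀ (levelSeq y)
  have hZ : levelSeq z ∈ levelBlocksZ τ (cellTermList τ L (profileOf q τ x₀, profileOf q τ y₀, profileOf q τ z₀)) 0 ↔
      profileOf q τ z = profileOf q τ z₀ := mem_admissibleSeqs_cell_iff hz₀ (levelSeq z)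
  by_cases hcell : profileOf q τ x = profileOf q τ x₀ ∧ profileOf q τ y = profileOf q τ y₀ ∧ profileOf q τ z = profileOf q τ z₀
  · rw [if_pos hcell, if_pos ⟨mem_admissibleSeqs_of_splitProfile_eq hcell.1 hx₀,
      mem_admissibleSeqs_of_splitProfile_eq hcell.2.1 hy₀, mem_admissibleSeqs_of_splitProfile_eq hcell.2.2 hz₀⟩,
      if_pos ⟨hX.2 hcell.1, hY.2 hcell.2.1, hZ.2 hcell.2.2⟩]
  · rw [if_neg hcell, if_neg]
    rintro ⟨h1, h2, h3⟩
    exact hcell ⟨hX.1 h1, hY.1 h2, hZ.1 h3⟩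

/-- **The realised cells**: triples of profiles of supported entries of `𝒯_{τ,L,ε}`. [cite: VassilevskaWilliamsXuXuZhou2024, Thm. 5.3 (proof)] -/
def realisedCells (τ : Fin n → Fin s) (L : Fin s → InterfaceTerm c) (ε : ℝ) :
    Finset ((Fin s → (Fin c → Fin 3) → Fin (n + 1)) × (Fin s → (Fin c → Fin 3) → Fin (n + 1)) ×
      (Fin s → (Fin c → Fin 3) → Fin (n + 1))) := by
  classical
  exact univ.filter fun abc => ∃ x y z : Fin n → Fin c → Fin (q + 2),
    interfaceTensor K q τ L ε x y z ≠ 0 ∧ abc = (profileOf q τ x, profileOf q τ y, profileOf q τ z)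

/-- A realised cell is realised by admissible blocks. [cite: VassilevskaWilliamsXuXuZhou2024, Thm. 5.3 (proof)] -/
theorem exists_blocks_of_mem_realisedCells {τ : Fin n → Fin s} {L : Fin s → InterfaceTerm c} {ε : ℝ}
    {abc : (Fin s → (Fin c → Fin 3) → Fin (n + 1)) × (Fin s → (Fin c → Fin 3) → Fin (n + 1)) ×
      (Fin s → (Fin c → Fin 3) → Fin (n + 1))} (h : abc ∈ realisedCells K q τ L ε) :
    ∃ x₀ y₀ z₀ : Fin n → Fin c → Fin (q + 2), levelSeq x₀ ∈ levelBlocksX τ L ε ∧ levelSeq y₀ ∈ levelBlocksY τ L ε ∧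
      levelSeq z₀ ∈ levelBlocksZ τ L ε ∧ abc = (profileOf q τ x₀, profileOf q τ y₀, profileOf q τ z₀) := by
  classical
  unfold realisedCells at h
  rw [mem_filter] at h
  obtain ⟨-, x, y, z, hne, habc⟩ := h
  rw [interfaceTensor_apply] at hne
  by_cases hmem : levelSeq x ∈ levelBlocksX τ L ε ∧ levelSeq y ∈ levelBlocksY τ L ε ∧ levelSeq z ∈ levelBlocksZ τ L ε
  · exact ⟨x, y, z, hmem.1, hmem.2.1, hmem.2.2, habc⟩
  · rw [if_neg hmem] at hne
    exact absurd rfl hne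

/-- **At most `((n+1)^{3^c s})^3` realised cells** (polynomially many for fixed `c, s`: the `2^{o(n)}`
copies of the input of Thm. 5.3). [cite: VassilevskaWilliamsXuXuZhou2024, Thm. 5.3 ("2^{o(n)} independent copies")] -/
theorem card_realisedCells_le (τ : Fin n → Fin s) (L : Fin s → InterfaceTerm c) (ε : ℝ) :
    (realisedCells K q τ L ε).card ≤ ((n + 1) ^ (3 ^ c * s)) ^ 3 := by
  classical
  have hlab : Fintype.card (Fin s → (Fin c → Fin 3) → Fin (n + 1)) = (n + 1) ^ (3 ^ c * s) := by
    rw [Fintype.card_fun, Fintype.card_fun, Fintype.card_fun, Fintype.card_fin, Fintype.card_fin, Fintype.card_fin,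
      ← pow_mul, Fintype.card_fin]
  refine (card_le_univ _).trans (le_of_eq ?_)
  rw [Fintype.card_prod, Fintype.card_prod, hlab]
  ring

open scoped Classical in
/-- **VXXZ Thm. 5.3, the merge step**: the `ε`-interface tensor is a restriction of the direct sum,
over its realised cells, of the exact interface tensors of the cell data (whose split distributions
are within `ε` of the prescribed ones, `abs_cellGamma_sub_le`).
[cite: VassilevskaWilliamsXuXuZhou2024, Thm. 5.3 (proof: "Finally, we merge the level-ℓ interface tensors into a level-ℓ ε-interface tensor")] -/
theorem vxxz2024_thm53_merge (τ : Fin n → Fin s) (L : Fin s → InterfaceTerm c) (ε : ℝ) :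
    TensorRestrictsTo
      (familyDirectSum fun abc : ↥(realisedCells K q τ L ε) => interfaceTensor K q τ (cellTermList τ L abc.1) 0)
      (interfaceTensor K q τ L ε) := by
  classical
  have h := tensorRestrictsTo_directSum_cells_of_subset (profileOf q τ) (profileOf q τ) (profileOf q τ)
    (interfaceTensor K q τ L ε) (e := fun abc : ↥(realisedCells K q τ L ε) => abc.1) Subtype.val_injective
    (fun x y z hne => ⟨⟨(profileOf q τ x, profileOf q τ y, profileOf q τ z), by
      unfold realisedCells; exact mem_filter.2 ⟨mem_univ _, x, y, z, hne, rfl⟩⟩, rfl⟩)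
  have key : (fun abc : ↥(realisedCells K q τ L ε) => partSubtensor (profileOf q τ) (profileOf q τ) (profileOf q τ)
      (interfaceTensor K q τ L ε) {abc.1.1} {abc.1.2.1} {abc.1.2.2}) =
      fun abc => interfaceTensor K q τ (cellTermList τ L abc.1) 0 := by
    funext abc
    obtain ⟨x₀, y₀, z₀, hx₀, hy₀, hz₀, habc⟩ := exists_blocks_of_mem_realisedCells K q abc.2
    have e1 : abc.1 = (profileOf q τ x₀, profileOf q τ y₀, profileOf q τ z₀) := habc
    rw [e1]
    exact partSubtensor_interfaceTensor_cell_eq K q τ L ε hx₀ hy₀ hz₀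
  rw [key] at h
  exact h

end Cells

end Literature.Computability.AlgebraicComplexity
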